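import Literature.NumberTheory.GaloisRepresentations.InertiaRootsOfUnity
import Mathlib.RingTheory.Valuation.ValuationSubring
import Mathlib.RingTheory.LocalRing.ResidueField.Basic
import Mathlib.FieldTheory.IsAlgClosed.AlgebraicClosure
import HarnessLib

/-!
# The valuation ring of `F̄` for a non-archimedean local field `F`, its residue field and the
Galois action

Let `F` be a non-archimedean local field, `F̄ = AlgebraicClosure F`, `‖·‖ = algNorm F` the
absolute value of `F̄` extending that of `F` (`InertiaRootsOfUnity.lean`; Neukirch, *ANT*, II
(4.8)).  This file packages the closed unit ball `R = {x ∈ F̄ : ‖x‖ ≤ 1}` as a Mathlib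
`ValuationSubring F̄` (`closureValuationSubring F`; as a set it is the ring of absolute integers
`absIntegers 𝒪[F] F`, `mem_closureValuationSubring_iff_mem_absIntegers`), so that Mathlib's
valuation-ring API (`ValuationRing`, `IsFractionRing R F̄`, `IsLocalRing`, `ResidueField`) and the
valuative criterion of properness (`Literature/AlgebraicGeometry/Motives/ProperIntegralPoints`)
apply to it, and records:

* `𝒪[F] → R` (`integerToClosureValuationSubring`, a local homomorphism) and the maximal ideal
  `𝔪_R = {‖x‖ < 1}` (`mem_maximalIdeal_closureValuationSubring_iff`);
* the residue field `κ(R)` is **algebraically closed** (`isAlgClosed_residueField`: lift a monic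
  polynomial to `R`, take a root in `F̄`, which is integral over the integrally closed `R`) and
  **algebraic over `𝓀[F]`** (`R` is integral over `𝒪[F]`), i.e. an algebraic closure of `𝓀[F]`
  (Serre, *Local Fields*, Ch. IV §4, Cor. 2 to Prop. 16 / Ch. II §2);
* the action of `Γ_F` on `R` (`closureValuationSubringMap σ`, `‖σ x‖ = ‖x‖`) and on `κ(R)`
  (`residueFieldMap σ`), and **the inertia group acts trivially on `κ(R)`**
  (`residueFieldMap_eq_id_of_mem_absInertia`, from `mem_absInertia_iff_algNorm`: `σ ∈ I_F` iff
  `‖σ b - b‖ < 1` on the unit ball — Neukirch II (9.3)).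

These are the local ingredients of the reduction map of an abelian variety with good reduction
(`Literature/NumberTheory/DiophantineGeometry/`): `Γ_{K_v}` acts on the special fibre through
`κ(R)`, with inertia acting trivially.

## References
* [NeukirchANT1999] J. Neukirch, *Algebraic Number Theory*, Ch. II (4.8) (the valuation of `F̄`,
  valuation ring = integral closure), (9.3) (inertia group).
* [SerreLocalFields1979] J.-P. Serre, *Local Fields*, Ch. II §2 Prop. 3; Ch. IV §4 Cor. 2 to
  Prop. 16 (residue field of `F̄` is an algebraic closure of `k`).
-/

noncomputable section

open ValuativeRel Field IsLocalRing Polynomial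
open scoped Pointwise

namespace Literature.NumberTheory.GaloisRepresentations

open GaloisRepresentations.IsNonarchimedeanLocalField

variable (F : Type*) [Field F] [ValuativeRel F] [TopologicalSpace F] [IsNonarchimedeanLocalField F]

/-- **The valuation ring `R = {x ∈ F̄ : ‖x‖ ≤ 1}` of `F̄`** (closed unit ball of `algNorm F`), as a
valuation subring of `F̄ = AlgebraicClosure F`.  Neukirch, *ANT*, Ch. II (4.8).
[cite: NeukirchANT1999, Ch. II (4.8)] -/
def closureValuationSubring : ValuationSubring (AlgebraicClosure F) where
  carrier := {x | algNorm F x ≤ 1}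
  mul_mem' {a b} ha hb := by
    change algNorm F (a * b) ≤ 1
    rw [algNorm_mul]
    exact mul_le_one₀ ha (algNorm_nonneg b) hb
  one_mem' := by
    change algNorm F 1 ≤ 1
    rw [algNorm_one]
  add_mem' {a b} ha hb := (algNorm_add_le a b).trans (max_le ha hb)
  zero_mem' := by
    change algNorm F 0 ≤ 1
    rw [algNorm_zero]
    exact zero_le_one
  neg_mem' {a} ha := by
    change algNorm F (-a) ≤ 1
    rwa [algNorm_neg]
  mem_or_inv_mem' a := by
    change algNorm F a ≤ 1 ∨ algNorm F a⁻¹ ≤ 1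
    rw [algNorm_inv]
    rcases le_or_gt (algNorm F a) 1 with h | h
    · exact Or.inl h
    · exact Or.inr (inv_le_one_of_one_le₀ h.le)

variable {F}

/-- `x ∈ R ↔ ‖x‖ ≤ 1`. [folklore] -/
theorem mem_closureValuationSubring_iff {x : AlgebraicClosure F} :
    x ∈ closureValuationSubring F ↔ algNorm F x ≤ 1 :=
  Iff.rfl

/-- Elements of `R` have norm `≤ 1`. [folklore] -/
theorem algNorm_coe_closureValuationSubring_le (x : closureValuationSubring F) :
    algNorm F (x : AlgebraicClosure F) ≤ 1 :=
  x.2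

/-- `R` is the ring of absolute integers `S = absIntegers 𝒪[F] F` (as a set).
[cite: NeukirchANT1999, Ch. II (4.8)] -/
theorem mem_closureValuationSubring_iff_mem_absIntegers {x : AlgebraicClosure F} :
    x ∈ closureValuationSubring F ↔ x ∈ absIntegers 𝒪[F] F := by
  rw [mem_closureValuationSubring_iff, mem_absIntegers_iff_algNorm_le_one]

/-- `Γ_F` preserves `R` (it acts by isometries). [cite: NeukirchANT1999, Ch. II (4.8)] -/
theorem smul_mem_closureValuationSubring_iff (σ : absoluteGaloisGroup F) {x : AlgebraicClosure F} :
    σ • x ∈ closureValuationSubring F ↔ x ∈ closureValuationSubring F := by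
  rw [mem_closureValuationSubring_iff, mem_closureValuationSubring_iff, algNorm_smul]

/-- `𝒪[F] ⊆ R`. [folklore] -/
theorem algebraMap_mem_closureValuationSubring (a : 𝒪[F]) :
    algebraMap 𝒪[F] (AlgebraicClosure F) a ∈ closureValuationSubring F :=
  algNorm_algebraMap_integer a

/-- Units of `R` are the elements of norm `1`. [folklore] -/
theorem isUnit_closureValuationSubring_iff (x : closureValuationSubring F) :
    IsUnit x ↔ algNorm F (x : AlgebraicClosure F) = 1 := by
  constructor
  · rintro ⟨u, rfl⟩
    have h1 : algNorm F ((u.val : closureValuationSubring F) : AlgebraicClosure F) *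
        algNorm F ((u.inv : closureValuationSubring F) : AlgebraicClosure F) = 1 := by
      rw [← algNorm_mul, ← MulMemClass.coe_mul, u.val_inv, OneMemClass.coe_one, algNorm_one]
    by_contra hne
    have hlt := mul_lt_one_of_nonneg_of_lt_one_left (algNorm_nonneg _)
      (lt_of_le_of_ne (u.val).2 hne) (u.inv).2
    exact hlt.ne h1
  · intro h
    have hx0 : (x : AlgebraicClosure F) ≠ 0 := fun h0 ↦ by
      rw [h0, algNorm_zero] at h
      exact zero_ne_one h
    have hinv : (x : AlgebraicClosure F)⁻¹ ∈ closureValuationSubring F := by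
      rw [mem_closureValuationSubring_iff, algNorm_inv, h, inv_one]
    refine ⟨⟨x, ⟨_, hinv⟩, Subtype.ext (mul_inv_cancel₀ hx0), Subtype.ext (inv_mul_cancel₀ hx0)⟩,
      rfl⟩

/-- **The maximal ideal of `R` is the open unit ball**: `x ∈ 𝔪_R ↔ ‖x‖ < 1`.
[cite: NeukirchANT1999, Ch. II (4.8)] -/
theorem mem_maximalIdeal_closureValuationSubring_iff (x : closureValuationSubring F) :
    x ∈ maximalIdeal (closureValuationSubring F) ↔ algNorm F (x : AlgebraicClosure F) < 1 := by
  rw [IsLocalRing.mem_maximalIdeal, mem_nonunits_iff, isUnit_closureValuationSubring_iff]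
  exact ⟨fun h ↦ lt_of_le_of_ne x.2 h, fun h ↦ h.ne⟩

variable (F)

/-- The structure map `𝒪[F] → R`. [folklore] -/
def integerToClosureValuationSubring : 𝒪[F] →+* closureValuationSubring F :=
  (algebraMap 𝒪[F] (AlgebraicClosure F)).codRestrict _ algebraMap_mem_closureValuationSubring

/-- `𝒪[F] → R ⊆ F̄` is the structure map `𝒪[F] → F̄`. [folklore] -/
@[simp] theorem coe_integerToClosureValuationSubring (a : 𝒪[F]) :
    ((integerToClosureValuationSubring F a : closureValuationSubring F) : AlgebraicClosure F) =
      algebraMap 𝒪[F] (AlgebraicClosure F) a :=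
  rfl

/-- `𝒪[F] → R` is a local homomorphism (`𝔪_R ∩ 𝒪[F] = 𝓂[F]`). [folklore] -/
instance isLocalHom_integerToClosureValuationSubring :
    IsLocalHom (integerToClosureValuationSubring F) := by
  refine ⟨fun a ha ↦ ?_⟩
  by_contra hna
  have hmem : a ∈ 𝓂[F] := (IsLocalRing.mem_maximalIdeal _).mpr hna
  have hlt := algNorm_algebraMap_lt_one_of_mem_maximalIdeal hmem
  rw [isUnit_closureValuationSubring_iff, coe_integerToClosureValuationSubring] at ha
  exact hlt.ne ha

/-! ## The residue field `κ(R)`: algebraically closed and algebraic over `𝓀[F]` -/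

/-- **The residue field of `F̄` is algebraically closed**: a monic polynomial over `κ(R)` lifts to
a monic polynomial over `R`, which has a root in the algebraically closed field `F̄`; the root is
integral over the integrally closed ring `R`, hence lies in `R`, and reduces to a root.
Serre, *Local Fields*, Ch. IV §4, Cor. 2 to Prop. 16. [cite: SerreLocalFields1979, Ch. IV §4 Cor. 2 to Prop. 16] -/
instance isAlgClosed_residueField :
    IsAlgClosed (ResidueField (closureValuationSubring F)) := by
  refine IsAlgClosed.of_exists_root _ fun p hp hirr ↦ ?_
  have hlifts : p ∈ Polynomial.lifts (IsLocalRing.residue (closureValuationSubring F)) := by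
    rw [Polynomial.lifts_iff_coeff_lifts]
    intro n
    exact IsLocalRing.residue_surjective (p.coeff n)
  obtain ⟨P, hPp, hPdeg, hPmonic⟩ := Polynomial.lifts_and_degree_eq_and_monic hlifts hp
  have hdegp : p.degree ≠ 0 :=
    (Polynomial.degree_pos_of_ne_zero_of_nonunit hirr.ne_zero hirr.not_isUnit).ne'
  have hdegQ : (P.map (algebraMap (closureValuationSubring F) (AlgebraicClosure F))).degree ≠ 0 := by
    rw [hPmonic.degree_map, hPdeg]
    exact hdegp
  obtain ⟨α, hα⟩ := IsAlgClosed.exists_root _ hdegQ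
  -- `α` is integral over `R`, hence in `R`
  have hαint : IsIntegral (closureValuationSubring F) α :=
    ⟨P, hPmonic, by rwa [← Polynomial.eval_map]⟩
  obtain ⟨a, ha⟩ := IsIntegrallyClosed.algebraMap_eq_of_integral hαint
  refine ⟨IsLocalRing.residue _ a, ?_⟩
  have hPa : P.eval a = 0 := by
    apply FaithfulSMul.algebraMap_injective (closureValuationSubring F) (AlgebraicClosure F)
    rw [map_zero, ← Polynomial.aeval_algebraMap_apply_eq_algebraMap_eval, Polynomial.aeval_def, ha,
      ← Polynomial.eval_map]
    exact hα
  rw [← hPp, Polynomial.eval_map, Polynomial.eval₂_hom, hPa, map_zero]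

/-- The `𝓀[F]`-algebra structure of `κ(R)` induced by the local map `𝒪[F] → R`. [folklore] -/
instance residueFieldAlgebra : Algebra 𝓀[F] (ResidueField (closureValuationSubring F)) :=
  (ResidueField.map (integerToClosureValuationSubring F)).toAlgebra

/-- `algebraMap 𝓀[F] κ(R) (ā) = (a)̄`. [folklore] -/
theorem algebraMap_residueField_residue (a : 𝒪[F]) :
    algebraMap 𝓀[F] (ResidueField (closureValuationSubring F)) (IsLocalRing.residue 𝒪[F] a) =
      IsLocalRing.residue (closureValuationSubring F) (integerToClosureValuationSubring F a) :=
  rfl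

/-- **`κ(R)` is algebraic over `𝓀[F]`** (every element of `R` is integral over `𝒪[F]`, `R` being
the integral closure of `𝒪[F]` in `F̄`; reduce an integral equation).
Serre, *Local Fields*, Ch. II §2 Prop. 3. [cite: SerreLocalFields1979, Ch. II §2 Prop. 3] -/
instance residueField_isAlgebraic :
    Algebra.IsAlgebraic 𝓀[F] (ResidueField (closureValuationSubring F)) := by
  have hint : Algebra.IsIntegral 𝓀[F] (ResidueField (closureValuationSubring F)) := by
    refine ⟨fun r ↦ ?_⟩
    obtain ⟨x, rfl⟩ := IsLocalRing.residue_surjective r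
    have hxS : (x : AlgebraicClosure F) ∈ absIntegers 𝒪[F] F :=
      mem_closureValuationSubring_iff_mem_absIntegers.mp x.2
    obtain ⟨P, hPm, hPx⟩ : IsIntegral 𝒪[F] (x : AlgebraicClosure F) := hxS
    have hPx' : Polynomial.eval₂ (integerToClosureValuationSubring F) x P = 0 := by
      apply FaithfulSMul.algebraMap_injective (closureValuationSubring F) (AlgebraicClosure F)
      rw [Polynomial.hom_eval₂, map_zero]
      exact hPx
    refine ⟨P.map (IsLocalRing.residue 𝒪[F]), hPm.map _, ?_⟩
    rw [Polynomial.eval₂_map]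
    have h := congrArg (IsLocalRing.residue (closureValuationSubring F)) hPx'
    rw [Polynomial.hom_eval₂, map_zero] at h
    exact h
  exact Algebra.IsIntegral.isAlgebraic

/-- Hence `κ(R)` is an algebraic closure of `𝓀[F]`. [cite: SerreLocalFields1979, Ch. IV §4 Cor. 2 to Prop. 16] -/
instance residueField_isAlgClosure :
    IsAlgClosure 𝓀[F] (ResidueField (closureValuationSubring F)) where
  isAlgClosed := isAlgClosed_residueField F
  isAlgebraic := residueField_isAlgebraic F

/-! ## The action of `Γ_F` on `R` and on `κ(R)`; inertia acts trivially on `κ(R)` -/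

variable {F}

/-- The restriction of `σ ∈ Γ_F` to a ring endomorphism of `R` (an isometry preserves the unit
ball). [folklore] -/
def closureValuationSubringMap (σ : absoluteGaloisGroup F) :
    closureValuationSubring F →+* closureValuationSubring F where
  toFun x := ⟨σ • (x : AlgebraicClosure F), (smul_mem_closureValuationSubring_iff σ).mpr x.2⟩
  map_one' := Subtype.ext (smul_one σ)
  map_mul' x y := Subtype.ext (smul_mul' σ (x : AlgebraicClosure F) y)
  map_zero' := Subtype.ext (smul_zero σ)
  map_add' x y := Subtype.ext (smul_add σ (x : AlgebraicClosure F) y)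

/-- Underlying element of `σ|_R x`. [folklore] -/
@[simp] theorem coe_closureValuationSubringMap (σ : absoluteGaloisGroup F)
    (x : closureValuationSubring F) :
    ((closureValuationSubringMap σ x : closureValuationSubring F) : AlgebraicClosure F) =
      σ • (x : AlgebraicClosure F) :=
  rfl

/-- `σ|_R` fixes `𝒪[F]`. [folklore] -/
theorem closureValuationSubringMap_comp_integerToClosureValuationSubring (σ : absoluteGaloisGroup F) :
    (closureValuationSubringMap σ).comp (integerToClosureValuationSubring F) =
      integerToClosureValuationSubring F := by
  ext a
  change σ • algebraMap 𝒪[F] (AlgebraicClosure F) a = algebraMap 𝒪[F] (AlgebraicClosure F) a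
  rw [IsScalarTower.algebraMap_apply 𝒪[F] F (AlgebraicClosure F), absoluteGaloisGroup.smul_def,
    AlgEquiv.commutes]

/-- `σ|_R` is compatible with `σ` on `F̄ = Frac R`. [folklore] -/
theorem algebraMap_comp_closureValuationSubringMap (σ : absoluteGaloisGroup F) :
    (absoluteGaloisGroup.toAlgEquiv F σ).toAlgHom.toRingHom.comp
        (algebraMap (closureValuationSubring F) (AlgebraicClosure F)) =
      (algebraMap (closureValuationSubring F) (AlgebraicClosure F)).comp
        (closureValuationSubringMap σ) :=
  rfl

/-- `σ|_R` is multiplicative in `σ`. [folklore] -/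
theorem closureValuationSubringMap_mul (σ τ : absoluteGaloisGroup F) :
    closureValuationSubringMap (σ * τ) =
      (closureValuationSubringMap σ).comp (closureValuationSubringMap τ) :=
  RingHom.ext fun x ↦ Subtype.ext (mul_smul σ τ (x : AlgebraicClosure F))

/-- `1|_R = id`. [folklore] -/
theorem closureValuationSubringMap_one :
    closureValuationSubringMap (1 : absoluteGaloisGroup F) = RingHom.id _ :=
  RingHom.ext fun x ↦ Subtype.ext (one_smul _ (x : AlgebraicClosure F))

/-- `σ|_R` is a local homomorphism (it preserves the norm). [folklore] -/
instance isLocalHom_closureValuationSubringMap (σ : absoluteGaloisGroup F) :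
    IsLocalHom (closureValuationSubringMap σ) := by
  refine ⟨fun x hx ↦ ?_⟩
  rw [isUnit_closureValuationSubring_iff] at hx ⊢
  rwa [coe_closureValuationSubringMap, algNorm_smul] at hx

/-- The endomorphism `σ̄` of the residue field `κ(R)` induced by `σ ∈ Γ_F`. [folklore] -/
def residueFieldMap (σ : absoluteGaloisGroup F) :
    ResidueField (closureValuationSubring F) →+* ResidueField (closureValuationSubring F) :=
  ResidueField.map (closureValuationSubringMap σ)

/-- `σ̄ (x̄) = (σ x)̄`. [folklore] -/
@[simp] theorem residueFieldMap_residue (σ : absoluteGaloisGroup F) (x : closureValuationSubring F) :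
    residueFieldMap σ (IsLocalRing.residue _ x) = IsLocalRing.residue _ (closureValuationSubringMap σ x) :=
  rfl

/-- Compatibility of `σ̄` with the residue map, as ring homomorphisms. [folklore] -/
theorem residueFieldMap_comp_residue (σ : absoluteGaloisGroup F) :
    (residueFieldMap σ).comp (IsLocalRing.residue (closureValuationSubring F)) =
      (IsLocalRing.residue (closureValuationSubring F)).comp (closureValuationSubringMap σ) :=
  rfl

/-- `σ ↦ σ̄` is multiplicative. [folklore] -/
theorem residueFieldMap_mul (σ τ : absoluteGaloisGroup F) :
    residueFieldMap (σ * τ) = (residueFieldMap σ).comp (residueFieldMap τ) := by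
  refine RingHom.ext fun r ↦ ?_
  obtain ⟨x, rfl⟩ := IsLocalRing.residue_surjective r
  change IsLocalRing.residue _ (closureValuationSubringMap (σ * τ) x) = _
  rw [closureValuationSubringMap_mul]
  rfl

/-- `1̄ = id`. [folklore] -/
theorem residueFieldMap_one : residueFieldMap (1 : absoluteGaloisGroup F) = RingHom.id _ := by
  refine RingHom.ext fun r ↦ ?_
  obtain ⟨x, rfl⟩ := IsLocalRing.residue_surjective r
  change IsLocalRing.residue _ (closureValuationSubringMap 1 x) = _
  rw [closureValuationSubringMap_one]
  rfl

/-- `σ̄` fixes `𝓀[F]`. [folklore] -/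
theorem residueFieldMap_algebraMap (σ : absoluteGaloisGroup F) (c : 𝓀[F]) :
    residueFieldMap σ (algebraMap 𝓀[F] _ c) = algebraMap 𝓀[F] _ c := by
  obtain ⟨a, rfl⟩ := IsLocalRing.residue_surjective c
  change IsLocalRing.residue _ (closureValuationSubringMap σ (integerToClosureValuationSubring F a)) =
    IsLocalRing.residue _ (integerToClosureValuationSubring F a)
  congr 1
  exact RingHom.congr_fun (closureValuationSubringMap_comp_integerToClosureValuationSubring σ) a

/-- **The inertia group acts trivially on the residue field of `F̄`**: for `σ ∈ I_F`,
`σ̄ = id` on `κ(R)` (`‖σ x - x‖ < 1` on the unit ball, Neukirch II (9.3)).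
[cite: NeukirchANT1999, Ch. II (9.3) Definition] -/
theorem residueFieldMap_eq_id_of_mem_absInertia {σ : absoluteGaloisGroup F} (hσ : σ ∈ absInertia F) :
    residueFieldMap σ = RingHom.id _ := by
  refine RingHom.ext fun r ↦ ?_
  obtain ⟨x, rfl⟩ := IsLocalRing.residue_surjective r
  rw [residueFieldMap_residue, RingHom.id_apply, ← sub_eq_zero, ← map_sub,
    IsLocalRing.residue_eq_zero_iff, mem_maximalIdeal_closureValuationSubring_iff,
    AddSubgroupClass.coe_sub, coe_closureValuationSubringMap]
  exact (mem_absInertia_iff_algNorm.mp hσ) _ x.2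

/-- Elementwise form: `σ ∈ I_F` fixes every residue class. [cite: NeukirchANT1999, Ch. II (9.3) Definition] -/
theorem residue_closureValuationSubringMap_of_mem_absInertia {σ : absoluteGaloisGroup F}
    (hσ : σ ∈ absInertia F) (x : closureValuationSubring F) :
    IsLocalRing.residue _ (closureValuationSubringMap σ x) = IsLocalRing.residue _ x := by
  rw [← residueFieldMap_residue, residueFieldMap_eq_id_of_mem_absInertia hσ, RingHom.id_apply]

end Literature.NumberTheory.GaloisRepresentations
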